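import Mathlib
import Literature.Computability.AlgebraicComplexity.NewtonPolygonTauProductBounds
import Literature.Barriers.ValiantsHypothesis.MonotoneGapParseTrees
import HarnessLib

/-!
# The Newton-polygon τ-bound without cancellations: monotone sums of products have at most `kmt`
# vertices (KPTT 2015 §2; Hrubeš–Yehudayoff 2021, Remark 48)

P. Koiran, N. Portier, S. Tavenas, S. Thomassé, *A τ-conjecture for Newton polygons*, Found.
Comput. Math. 15 (2015) 185–197 (arXiv:1308.2286), §2 (held text p0004:L84–L91): "If there are no
cancellations (for instance, if the `f_ij` only have positive coefficients) then we indeed have a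
polynomial upper bound. In this case, `Newt(f)` is the convex hull of the union of the Newton
polygons of the `k` products. Each of these `k` Newton polygons has at most `mt` vertices, so
`Newt(f)` has at most `kmt` vertices and as many edges." P. Hrubeš, A. Yehudayoff, *Shadows of
Newton polytopes*, CCC 2021 (LIPIcs 200:9), Remark 48 (held text `paper:url-d136d073b26d`
p0018:L35–L37): "▶ Remark 48. Let `f` be as in (7) [`f = Σ_{i=1}^p Π_{j=1}^q f_{i,j}`,
`|supp(f_{i,j})| ≤ r`] with `f_ij` monotone. Then `Newt(f)` has at most `pqr` vertices" ("Theorem 33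
validates the conjecture in the monotone setting").

The tree's `newtonVertexCount_sum_prod_le_of_support_eq` (`NewtonPolygonTauProductBounds.lean`)
proves the `kmt` bound under the explicit no-cancellation hypothesis
`supp(Σ_i Π_j f_ij) = ⋃_i supp(Π_j f_ij)`. This file records the two printed INSTANCES in which
that hypothesis holds automatically (all theorems, 0 definitions, 0 named facts):

* `KPTT.newtonVertexCount_sum_prod_le_nnreal` — over the semiring `ℝ≥0` (no cancellation is
  possible: `supp(f + g) = supp f ∪ supp g`, the tree's Jerrum–Snir positivity calculus
  `JerrumSnir.support_add_eq`): `#vert Newt(Σ_{i<k} Π_{j<m} f_ij) ≤ k·m·t` for `t`-sparse `f_ij`,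
  `m ≥ 1`.
* `KPTT.newtonVertexCount_sum_prod_le_of_coeff_nonneg` — HY21 Remark 48 / KPTT's "positive
  coefficients": the same over `ℝ` for `f_ij` with nonnegative coefficients (monotone polynomials),
  by lifting to `ℝ≥0` (`map NNReal.toRealHom`, supports preserved).

Honest framing (val-lit): the monotone case of the (OPEN) Newton-polygon τ-conjecture
`KPTT.newtonTauConjecture`, as printed; nothing here bears on the conjecture itself or on
`VP ≠ VNP`, which is NOT proved.

## References

* P. Koiran, N. Portier, S. Tavenas, S. Thomassé, Found. Comput. Math. 15 (2015) 185–197,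
  arXiv:1308.2286, §2 [KoiranPortierTavenasThomasse2015].
* P. Hrubeš, A. Yehudayoff, *Shadows of Newton polytopes*, CCC 2021, LIPIcs 200:9, Remark 48
  [HrubesYehudayoff2021].
* M. Jerrum, M. Snir, J. ACM 29 (1982), §2.2 (positivity calculus; tree file
  `MonotoneGapParseTrees.lean`) [JerrumSnir1982].
-/

noncomputable section

open Finset MvPolynomial
open scoped NNReal

namespace Literature.Computability.AlgebraicComplexity

namespace KPTT

open Literature.Barriers.ValiantsHypothesis

/-! ### Over `ℝ≥0`: supports of sums are unions -/

/-- Over `ℝ≥0`, the support of a finite sum is the union of the supports (no cancellations).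
[cite: JerrumSnir1982, §2.2 (the homomorphism τ onto B); KoiranPortierTavenasThomasse2015, §2 ("if there are no cancellations")] -/
theorem support_finset_sum_eq_biUnion_nnreal {σ ι : Type*} [DecidableEq σ] [DecidableEq ι]
    (s : Finset ι) (P : ι → MvPolynomial σ ℝ≥0) :
    (∑ i ∈ s, P i).support = s.biUnion fun i => (P i).support := by
  induction s using Finset.induction_on with
  | empty => simp
  | insert a s ha ih =>
    rw [Finset.sum_insert ha, JerrumSnir.support_add_eq, ih, Finset.biUnion_insert]

/-- **KPTT 2015 §2, the no-cancellation bound over `ℝ≥0`** ("`Newt(f)` has at most `kmt` vertices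
and as many edges"): for `t`-sparse `f_ij ∈ ℝ≥0[X, Y]` and `m ≥ 1`, the Newton polygon of
`Σ_{i<k} Π_{j<m} f_ij` has at most `k·m·t` vertices — the Newton-polygon τ-bound holds in the
monotone setting. [cite: KoiranPortierTavenasThomasse2015, §2 (held text p0004:L84–L91)]
[cite: HrubesYehudayoff2021, Remark 48] -/
theorem newtonVertexCount_sum_prod_le_nnreal {k m t : ℕ} (hm : m ≠ 0)
    (f : Fin k → Fin m → MvPolynomial (Fin 2) ℝ≥0) (hf : ∀ i j, (f i j).support.card ≤ t) :
    newtonVertexCount (∑ i, ∏ j, f i j) ≤ k * m * t := by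
  classical
  exact newtonVertexCount_sum_prod_le_of_support_eq hm f hf
    (support_finset_sum_eq_biUnion_nnreal Finset.univ fun i => ∏ j, f i j)

/-! ### Over `ℝ` with nonnegative coefficients (monotone polynomials) -/

/-- The `ℝ≥0`-lift of a real polynomial with nonnegative coefficients maps back to it.
[folklore] -/
private theorem map_toRealHom_lift {σ : Type*} (p : MvPolynomial σ ℝ) (hp : ∀ e, 0 ≤ p.coeff e) :
    map NNReal.toRealHom (∑ e ∈ p.support, monomial e (p.coeff e).toNNReal) = p := by
  classical
  rw [map_sum]
  conv_rhs => rw [p.as_sum]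
  refine Finset.sum_congr rfl fun e _ => ?_
  rw [map_monomial, NNReal.coe_toRealHom, Real.coe_toNNReal _ (hp e)]

/-- The support of the lift is contained in the support. [folklore] -/
private theorem support_lift_subset {σ : Type*} (p : MvPolynomial σ ℝ) :
    (∑ e ∈ p.support, monomial e (p.coeff e).toNNReal : MvPolynomial σ ℝ≥0).support ⊆ p.support := by
  classical
  intro x hx
  obtain ⟨e, he, hxe⟩ := Finset.mem_biUnion.1 (MvPolynomial.support_sum hx)
  have hsub := MvPolynomial.support_monomial_subset hxe
  rw [Finset.mem_singleton] at hsub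
  rw [hsub]; exact he

/-- `newtonVertexCount` is unchanged under an injective change of coefficients (same support).
[folklore] -/
private theorem newtonVertexCount_map_of_injective {R S : Type*} [CommSemiring R] [CommSemiring S]
    {φ : R →+* S} (hφ : Function.Injective φ) (p : MvPolynomial (Fin 2) R) :
    newtonVertexCount (map φ p) = newtonVertexCount p := by
  unfold newtonVertexCount
  rw [MvPolynomial.support_map_of_injective p hφ]

/-- **Hrubeš–Yehudayoff 2021, Remark 48 (the Newton-polygon τ-conjecture in the monotone
setting)** = KPTT §2's "for instance, if the `f_ij` only have positive coefficients": for
bivariate real polynomials `f_ij` with NONNEGATIVE coefficients and at most `t` monomials each,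
`m ≥ 1`, `Newt(Σ_{i<k} Π_{j<m} f_ij)` has at most `k·m·t` vertices. (Printed with `(p, q, r)` for
`(k, m, t)`: "Let `f` be as in (7) with `f_ij` monotone. Then `Newt(f)` has at most `pqr`
vertices.") Proof: lift to `ℝ≥0` and apply `newtonVertexCount_sum_prod_le_nnreal`.
[cite: HrubesYehudayoff2021, Remark 48 (held text p0018:L35–L37)]
[cite: KoiranPortierTavenasThomasse2015, §2 (held text p0004:L84–L91)] -/
theorem newtonVertexCount_sum_prod_le_of_coeff_nonneg {k m t : ℕ} (hm : m ≠ 0)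
    (f : Fin k → Fin m → MvPolynomial (Fin 2) ℝ) (hpos : ∀ i j e, 0 ≤ (f i j).coeff e)
    (hf : ∀ i j, (f i j).support.card ≤ t) :
    newtonVertexCount (∑ i, ∏ j, f i j) ≤ k * m * t := by
  classical
  -- the lift
  set g : Fin k → Fin m → MvPolynomial (Fin 2) ℝ≥0 :=
    fun i j => ∑ e ∈ (f i j).support, monomial e ((f i j).coeff e).toNNReal with hg
  have hmap : ∀ i j, map NNReal.toRealHom (g i j) = f i j := fun i j =>
    map_toRealHom_lift (f i j) (hpos i j)
  have hsum : ∑ i, ∏ j, f i j = map NNReal.toRealHom (∑ i, ∏ j, g i j) := by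
    rw [map_sum]
    refine Finset.sum_congr rfl fun i _ => ?_
    rw [map_prod]
    exact Finset.prod_congr rfl fun j _ => (hmap i j).symm
  have hg' : ∀ i j, (g i j).support.card ≤ t := fun i j =>
    (Finset.card_le_card (support_lift_subset (f i j))).trans (hf i j)
  rw [hsum, newtonVertexCount_map_of_injective NNReal.coe_injective]
  exact newtonVertexCount_sum_prod_le_nnreal hm g hg'

end KPTT

end Literature.Computability.AlgebraicComplexity
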